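import Mathlib
import HarnessLib
import Summits.ResolutionOfSingularities.ResolutionOfSingularities.Theorems.WildQuotientsWildQuotientResolutionS1aValuativeProducers

/-!
# S1a — THE FIRST INSTANCE: the monomial valuation at the origin of affine space and its valuation ideals

[OURS · L1 W4.5c · lead-1 g9, SUCCESSOR-BRIEF-v1.2 §4 items 1–2 (the producers exercised on the census' home chart)] — NOT statements of the manuscript;
counted 0; AI-level work, weaker than expert review. Crux stmt-ResolutionOfSingularities-17941 (`WildQuotients.CyclicQuotientFourfolds`), line `s1a-logminvertex`
v10. Route-independent; pure scheme/algebra level.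

On `𝔸^σ_k = Spec k[x_σ]` (`affineSpace σ k`) with its origin `origin σ k` (the kernel of evaluation at `0`): the power-series expansion
`originExpansion : Γ(𝔸^σ, ⊤) ≅ k[x_σ] ↪ k⟦x_σ⟧` is CENTRED at the origin (`isUnit_originExpansion_iff`), so every positive weight vector `w` gives the
**monomial valuation** `monomialVal σ k w hw : CentredVal (affineSpace σ k) (origin σ k)` (`CentredVal.ofPowerSeries`), and its valuation ideals on the chart
`⊤` are COMPUTED: `mem_valIdeal_monomialVal_iff` (`f ∈ 𝒥ₙ ↔ n ≤ weightedOrder w f`), `le_weightedOrder_coe_iff` (all coefficients of weight `< n` vanish),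
`le_weightedOrder_coe_iff_mem_span` (membership in the MONOMIAL IDEAL `(x^d : ⟨w, d⟩ ≥ n)`), ★★ `valIdeal_monomialVal_eq`: `𝒥ₙ(⊤) = (x^d : ⟨w, d⟩ ≥ n)` read
through `ΓSpecIso` — the weighted-monomial shape that the filtration clause of `IsCentreChart` / `IsPrincipalCentreChart` asks for.
-/

set_option linter.dupNamespace false

noncomputable section

universe u

open CategoryTheory Limits AlgebraicGeometry TopologicalSpace Topology Opposite
open Literature.AlgebraicGeometry.Resolution

namespace Summit.ResolutionOfSingularities.ResolutionOfSingularities.Theorems.WildQuotientResolution.S1.Valuative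

/-! ## Weighted order of a polynomial, read in power series -/

section Poly

variable {σ k : Type*} [Field k] (w : σ → ℕ)

/-- `weight w` is monotone in the exponent. -/
theorem weight_le_weight_of_le {d d' : σ →₀ ℕ} (h : d ≤ d') : Finsupp.weight w d ≤ Finsupp.weight w d' := by
  obtain ⟨c, rfl⟩ := le_iff_exists_add.1 h
  rw [map_add]
  exact Nat.le_add_right _ _

/-- The constant coefficient of a polynomial read as a power series. -/
theorem constantCoeff_coe (φ : MvPolynomial σ k) : MvPowerSeries.constantCoeff (φ : MvPowerSeries σ k) = MvPolynomial.constantCoeff φ := by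
  rw [← MvPowerSeries.coeff_zero_eq_constantCoeff_apply, MvPolynomial.coeff_coe]
  exact (congrFun MvPolynomial.constantCoeff_eq φ).symm

/-- A polynomial is a unit power series iff its constant coefficient is non-zero. -/
theorem isUnit_coe_iff (φ : MvPolynomial σ k) : IsUnit (φ : MvPowerSeries σ k) ↔ MvPolynomial.constantCoeff φ ≠ 0 := by
  rw [MvPowerSeries.isUnit_iff_constantCoeff, constantCoeff_coe, isUnit_iff_ne_zero]

/-- `n ≤` the weighted order of a polynomial iff all its coefficients of weight `< n` vanish. -/
theorem le_weightedOrder_coe_iff (φ : MvPolynomial σ k) (n : ℕ) :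
    (n : ℕ∞) ≤ MvPowerSeries.weightedOrder w (φ : MvPowerSeries σ k) ↔ ∀ d, MvPolynomial.coeff d φ ≠ 0 → n ≤ Finsupp.weight w d := by
  constructor
  · intro h d hd
    by_contra hlt
    rw [not_le] at hlt
    have h0 := MvPowerSeries.coeff_eq_zero_of_lt_weightedOrder w (f := (φ : MvPowerSeries σ k)) (d := d) (lt_of_lt_of_le (by exact_mod_cast hlt) h)
    rw [MvPolynomial.coeff_coe] at h0
    exact hd h0
  · intro h
    apply MvPowerSeries.nat_le_weightedOrder
    intro d hd
    rw [MvPolynomial.coeff_coe]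
    by_contra hne
    exact absurd (h d hne) (not_le.2 hd)

/-- … iff the polynomial lies in the MONOMIAL IDEAL `(x^d : ⟨w, d⟩ ≥ n)`. -/
theorem le_weightedOrder_coe_iff_mem_span (φ : MvPolynomial σ k) (n : ℕ) :
    (n : ℕ∞) ≤ MvPowerSeries.weightedOrder w (φ : MvPowerSeries σ k) ↔
      φ ∈ Ideal.span ((fun d => MvPolynomial.monomial d (1 : k)) '' {d | n ≤ Finsupp.weight w d}) := by
  rw [le_weightedOrder_coe_iff, MvPolynomial.mem_ideal_span_monomial_image]
  constructor
  · intro h xi hxi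
    exact ⟨xi, h xi (MvPolynomial.mem_support_iff.1 hxi), le_rfl⟩
  · intro h d hd
    obtain ⟨si, hsi, hle⟩ := h d (MvPolynomial.mem_support_iff.2 hd)
    exact le_trans hsi (weight_le_weight_of_le w hle)

end Poly

/-! ## Affine space, its origin, the expansion at the origin -/

section AffineSpace

variable (σ k : Type u) [Field k]

/-- Affine space `𝔸^σ_k = Spec k[x_σ]`. -/
abbrev affineSpace : Scheme.{u} := Spec (.of (MvPolynomial σ k))

/-- The origin of `𝔸^σ_k`: the kernel of evaluation at `0`. -/
def origin : ↥(affineSpace σ k) :=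
  (⟨RingHom.ker (MvPolynomial.eval (0 : σ → k)), RingHom.ker_isPrime _⟩ : PrimeSpectrum (MvPolynomial σ k))

/-- A polynomial vanishes at the origin iff its constant coefficient does. -/
theorem mem_origin_asIdeal_iff (f : MvPolynomial σ k) : f ∈ (origin σ k).asIdeal ↔ MvPolynomial.constantCoeff f = 0 := by
  change f ∈ RingHom.ker (MvPolynomial.eval (0 : σ → k)) ↔ _
  rw [RingHom.mem_ker, MvPolynomial.eval_zero]

/-- **The power-series expansion at the origin**: `Γ(𝔸^σ, ⊤) ≅ k[x_σ] ↪ k⟦x_σ⟧`. -/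
def originExpansion : Γ(affineSpace σ k, ⊤) →+* MvPowerSeries σ k :=
  (MvPolynomial.coeToMvPowerSeries.ringHom).comp (Scheme.ΓSpecIso (.of (MvPolynomial σ k))).hom.hom

/-- Unfolding. -/
theorem originExpansion_apply (f : Γ(affineSpace σ k, ⊤)) :
    originExpansion σ k f = (((Scheme.ΓSpecIso (.of (MvPolynomial σ k))).hom.hom f : MvPolynomial σ k) : MvPowerSeries σ k) := rfl

/-- ★ The expansion at the origin is CENTRED at the origin: a section is a unit power series iff the origin lies in its basic open. -/
theorem isUnit_originExpansion_iff (f : Γ(affineSpace σ k, ⊤)) :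
    IsUnit (originExpansion σ k f) ↔ (origin σ k) ∈ (affineSpace σ k).basicOpen f := by
  rw [basicOpen_eq_of_affine', originExpansion_apply, isUnit_coe_iff, Ne, ← mem_origin_asIdeal_iff]
  exact (PrimeSpectrum.mem_basicOpen _ (origin σ k)).symm

variable {σ k}

/-- ★★ **The monomial valuation at the origin of `𝔸^σ_k` with positive weights `w`** — a valuation centred at the origin (`CentredVal.ofPowerSeries` on the
expansion at the origin). [OURS · L1 W4.5c] -/
def monomialVal (w : σ → ℕ) (hw : ∀ i, 0 < w i) : CentredVal (affineSpace σ k) (origin σ k) :=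
  CentredVal.ofPowerSeries (X := affineSpace σ k) (U := ⊤) (isAffineOpen_top (affineSpace σ k)) ⟨origin σ k, trivial⟩
    (originExpansion σ k) (fun f => isUnit_originExpansion_iff σ k f) w hw

/-- The valuation ideals of the monomial valuation on the chart `⊤`: `f ∈ 𝒥ₙ ↔ n ≤ weightedOrder w f`. -/
theorem mem_valIdeal_monomialVal_iff (w : σ → ℕ) (hw : ∀ i, 0 < w i) {n : ℕ} (f : Γ(affineSpace σ k, ⊤)) :
    f ∈ (monomialVal w hw).valIdeal n ⟨⊤, isAffineOpen_top (affineSpace σ k)⟩ ↔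
      (n : ℕ∞) ≤ MvPowerSeries.weightedOrder w
        (((Scheme.ΓSpecIso (.of (MvPolynomial σ k))).hom.hom f : MvPolynomial σ k) : MvPowerSeries σ k) :=
  CentredVal.mem_valIdeal_ofPowerSeries_iff _ _ _ _ w hw f

/-- ★★ **THE VALUATION IDEALS OF THE MONOMIAL VALUATION ARE THE WEIGHTED MONOMIAL IDEALS**: `𝒥ₙ(⊤) = (x^d : ⟨w, d⟩ ≥ n)`, read through `ΓSpecIso`.
[OURS · L1 W4.5c] -/
theorem valIdeal_monomialVal_eq (w : σ → ℕ) (hw : ∀ i, 0 < w i) (n : ℕ) :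
    (monomialVal w hw).valIdeal n ⟨⊤, isAffineOpen_top (affineSpace σ k)⟩ =
      (Ideal.span ((fun d => MvPolynomial.monomial d (1 : k)) '' {d | n ≤ Finsupp.weight w d})).comap
        (Scheme.ΓSpecIso (.of (MvPolynomial σ k))).hom.hom := by
  ext f
  rw [mem_valIdeal_monomialVal_iff, Ideal.mem_comap, le_weightedOrder_coe_iff_mem_span]

/-- The support of every positive piece is the closure of the origin (a closed point: `= {origin}` once `k[x_σ]/𝔪₀ = k` is used; not needed here). -/
theorem support_monomialVal (w : σ → ℕ) (hw : ∀ i, 0 < w i) {n : ℕ} (hn : 0 < n) :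
    (((monomialVal (k := k) w hw).rees.ideal n).support : Set ↥(affineSpace σ k)) = closure {origin σ k} :=
  (monomialVal w hw).support_rees_ideal_eq hn

end AffineSpace

/-! ## The valuation ideals ARE the tree's weighted filtration of the coordinates (Włodarczyk, Lemma 2.1.9: "the valuation ideals of the monomial valuation") -/

section Weighted

variable {σ k : Type u} [Field k]

/-- The weighted monomials of the coordinate family `X` of `k[x_σ]` are the monomials `x^d` with `⟨w, d⟩ ≥ n`. -/
theorem weightedMonomials_X_eq (w : σ → ℕ) (n : ℕ) :
    weightedMonomials (MvPolynomial.X : σ → MvPolynomial σ k) w n =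
      (fun d => MvPolynomial.monomial d (1 : k)) '' {d | n ≤ Finsupp.weight w d} := by
  ext m
  constructor
  · rintro ⟨α, hα, rfl⟩
    exact ⟨α, hα, (MvPolynomial.prod_X_pow_eq_monomial (s := α) (R := k)).symm⟩
  · rintro ⟨α, hα, rfl⟩
    exact ⟨α, hα, MvPolynomial.prod_X_pow_eq_monomial (s := α) (R := k)⟩

/-- ★★★ **THE VALUATION IDEALS OF THE MONOMIAL VALUATION ARE THE WEIGHTED FILTRATION OF THE COORDINATES**:
`𝒥ₙ(⊤) = (weightedFiltration X w).ideal n` read through `ΓSpecIso` — the treeʼs `weightedFiltration` (CobordantBlowupFiltration, "the valuation ideals of the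
monomial valuation `ν(uᵢ) = wᵢ`", [cite: Wlodarczyk2022, Lemma 2.1.9]) is, on `k[x_σ]`, literally the valuative filtration of `monomialVal w`. [OURS · L1 W4.5c] -/
theorem valIdeal_monomialVal_eq_weightedFiltration (w : σ → ℕ) (hw : ∀ i, 0 < w i) (n : ℕ) :
    (monomialVal w hw).valIdeal n ⟨⊤, isAffineOpen_top (affineSpace σ k)⟩ =
      ((weightedFiltration (MvPolynomial.X : σ → MvPolynomial σ k) w).ideal n).comap
        (Scheme.ΓSpecIso (.of (MvPolynomial σ k))).hom.hom := by
  rw [valIdeal_monomialVal_eq]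
  change _ = (Ideal.span (weightedMonomials _ w n)).comap _
  rw [weightedMonomials_X_eq]

end Weighted

end Summit.ResolutionOfSingularities.ResolutionOfSingularities.Theorems.WildQuotientResolution.S1.Valuative

end
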